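import Literature.Analysis.Fourier.VaalerFunctionIntegralRepresentation
import Literature.Analysis.Fourier.CompactFourierPoissonTwist
import HarnessLib

/-!
# Vaaler's weight `φ(u) = πu(1−u)cot πu + u`, its periodised samples, and Ramaré's Lemma 16

This file continues `VaalerFunctionIntegralRepresentation.lean` (which proved Vaaler's Theorem 6 in
the form `H'(x) = W(x) := 4∫₀¹ φ(t) cos(2πxt) dt` for `H = B − K`, `B` the Beurling function and
`K(x) = sinc(πx)²`) and `CompactFourierPoissonTwist.lean` (Poisson summation for band-limited
Fourier pairs).  To stay definition-free the three auxiliary functions are passed as *hypotheses*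

* `hΦ : Φ = fun u => cos(πu)/(sinc(πu) + sinc(π(1−u))) + u` — Vaaler's `φ(u) = πu(1−u)cot(πu) + u`,
  written so that it is defined (and continuous) on all of `[0,1]`, `Φ(0) = 1`, `Φ(1) = 0`;
* `hG : G = fun y => if |y| ≤ 1 then 2Φ|y| else 0` — the Fourier transform of `W`
  (Vaaler's `2Ĵ`, supported in `[−1,1]`);
* `hW : W = fun x => 4∫₀¹ (t + πt(1−t)cot(πt)) cos(2πxt) dt` — `H'`.

Main results:

* `vaalerPhi_mem_Icc` : `0 ≤ Φ ≤ 1` on `[0,1]`; `one_sub_vaalerPhi_div_le` : `(1 − Φ(u))/u ≤ π²u/2`;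
  `integral_vaalerPhi` : `∫₀¹ Φ = 1/2`; `vaalerPhi_add_vaalerPhi_one_sub` : `Φ(u) + Φ(1−u) = 1`.
* `integral_vaalerG_mul_cexp` : `W y = ∫ G(u) e(uy) du` (so `(G, W)` is a band-limited Fourier pair
  in the sense of `CompactFourierPoissonTwist`).
* `hasSum_int_vaalerW` : `Σ_{k ∈ ℤ} W(δk) = 2/δ` for `0 < δ ≤ 1` (Poisson summation; only the
  term `m = 0` survives since `G` vanishes off `(−1,1)`), and `hasSum_nat_vaalerW` :
  `Σ_{n ≥ 1} W(δn) = 1/δ − 1`.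
* `hasSum_one_sub_vaalerH_div` : **Ramaré's Lemma 16**,
  `Σ_{n ≥ 1} (1 − H(δn))/n = −log δ − 1 + δ` for `0 < δ ≤ 1`, proved by differentiating in `δ`
  (term-wise derivative `−W(δn)`, locally uniformly summable by `|W(x)| ≤ 10e^{2π}/(1+x²)`),
  using the previous bullet and the value at `δ = 1` (`H(n) = 1` for `n ≥ 1`).

## References

* J. D. Vaaler, *Some extremal functions in Fourier analysis*, Bull. AMS 12 (1985) 183–216,
  Theorem 6 and (2.37) in the proof of Theorem 8. [cite: Vaaler1985, Thm. 6]
* O. Ramaré, *Approximate formulae for L(1,χ)*, Acta Arith. 100 (2001) 245–266, Lemma 7 p. 253,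
  Lemma 15 and Lemma 16 p. 259. [cite: Ramare2001LOneApproximateFormulae, Lemma 16]

Ramaré proves Lemma 16 from the explicit Fourier series of `F₃`; the `δ`-derivative/Poisson road used
here is a deviation chosen because the tree already has Poisson summation and `H' = W`.
-/

noncomputable section

open Real Filter Topology Set MeasureTheory intervalIntegral Complex

namespace Literature.Analysis.Fourier

/-! ## The weight `Φ(u) = cos(πu)/(sinc(πu) + sinc(π(1−u))) + u` (`= πu(1−u)cot(πu) + u` on `(0,1)`) -/

section Phi

/-- `0 ≤ sinc x` for `0 ≤ x ≤ π`. [folklore] -/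
private theorem sinc_nonneg_of_le_pi {x : ℝ} (h0 : 0 ≤ x) (h1 : x ≤ π) : 0 ≤ Real.sinc x := by
  rcases h0.eq_or_lt with rfl | hx
  · simp [Real.sinc_zero]
  · rw [Real.sinc_of_ne_zero hx.ne']
    exact div_nonneg (Real.sin_nonneg_of_nonneg_of_le_pi h0 h1) h0

/-- `0 < sinc x` for `0 ≤ x < π`. [folklore] -/
private theorem sinc_pos_of_lt_pi {x : ℝ} (h0 : 0 ≤ x) (h1 : x < π) : 0 < Real.sinc x := by
  rcases h0.eq_or_lt with rfl | hx
  · simp [Real.sinc_zero]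
  · rw [Real.sinc_of_ne_zero hx.ne']
    exact div_pos (Real.sin_pos_of_pos_of_lt_pi hx h1) hx

/-- The denominator `sinc(πu) + sinc(π(1−u))` is positive on `[0,1]`. [folklore] -/
private theorem sinc_add_sinc_pos {u : ℝ} (h0 : 0 ≤ u) (h1 : u ≤ 1) :
    0 < Real.sinc (π * u) + Real.sinc (π * (1 - u)) := by
  rcases le_or_gt u (1 / 2) with h | h
  · have h2 : 0 < Real.sinc (π * u) :=
      sinc_pos_of_lt_pi (by positivity) (by nlinarith [Real.pi_pos])
    have h3 : 0 ≤ Real.sinc (π * (1 - u)) :=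
      sinc_nonneg_of_le_pi (by nlinarith [Real.pi_pos]) (by nlinarith [Real.pi_pos])
    linarith
  · have h2 : 0 ≤ Real.sinc (π * u) :=
      sinc_nonneg_of_le_pi (by positivity) (by nlinarith [Real.pi_pos])
    have h3 : 0 < Real.sinc (π * (1 - u)) :=
      sinc_pos_of_lt_pi (by nlinarith [Real.pi_pos]) (by nlinarith [Real.pi_pos])
    linarith

variable {Φ : ℝ → ℝ}

/-- **`Φ` is continuous on `[0,1]`.** [cite: Vaaler1985, Thm. 6 («φ defined by continuity at 0 and 1»)] -/
theorem continuousOn_vaalerPhi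
    (hΦ : Φ = fun u => Real.cos (π * u) / (Real.sinc (π * u) + Real.sinc (π * (1 - u))) + u) :
    ContinuousOn Φ (Icc 0 1) := by
  subst hΦ
  refine ContinuousOn.add (ContinuousOn.div (by fun_prop) ?_ fun u hu =>
    (sinc_add_sinc_pos hu.1 hu.2).ne') continuousOn_id
  exact (Real.continuous_sinc.comp (by fun_prop)).continuousOn.add
    (Real.continuous_sinc.comp (by fun_prop)).continuousOn

/-- On `(0,1)`: `Φ(u) = πu(1−u)cot(πu) + u`. [cite: Vaaler1985, Thm. 6] -/
theorem vaalerPhi_eq_of_mem_Ioo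
    (hΦ : Φ = fun u => Real.cos (π * u) / (Real.sinc (π * u) + Real.sinc (π * (1 - u))) + u)
    {u : ℝ} (hu : u ∈ Ioo (0:ℝ) 1) :
    Φ u = π * u * (1 - u) * (Real.cos (π * u) / Real.sin (π * u)) + u := by
  subst hΦ
  have h0 : u ≠ 0 := hu.1.ne'
  have h1 : 1 - u ≠ 0 := by linarith [hu.2]
  have hs : Real.sin (π * u) ≠ 0 :=
    (Real.sin_pos_of_pos_of_lt_pi (by nlinarith [Real.pi_pos, hu.1]) (by nlinarith [Real.pi_pos, hu.2])).ne'
  have hD : Real.sinc (π * u) + Real.sinc (π * (1 - u)) = Real.sin (π * u) / (π * u * (1 - u)) := by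
    rw [Real.sinc_of_ne_zero (mul_ne_zero Real.pi_ne_zero h0),
      Real.sinc_of_ne_zero (mul_ne_zero Real.pi_ne_zero h1),
      show π * (1 - u) = π - π * u by ring, Real.sin_pi_sub]
    field_simp
    ring
  simp only [hD]
  congr 1
  field_simp

/-- `Φ(0) = 1`, `Φ(1) = 0`. [cite: Vaaler1985, Thm. 6] -/
theorem vaalerPhi_zero_one
    (hΦ : Φ = fun u => Real.cos (π * u) / (Real.sinc (π * u) + Real.sinc (π * (1 - u))) + u) :
    Φ 0 = 1 ∧ Φ 1 = 0 := by
  subst hΦ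
  have : Real.sinc π = 0 := by rw [Real.sinc_of_ne_zero Real.pi_ne_zero, Real.sin_pi, zero_div]
  constructor <;> simp [this]

/-- `Φ(u) + Φ(1−u) = 1`. [cite: Vaaler1985, Thm. 6] -/
theorem vaalerPhi_add_vaalerPhi_one_sub
    (hΦ : Φ = fun u => Real.cos (π * u) / (Real.sinc (π * u) + Real.sinc (π * (1 - u))) + u)
    (u : ℝ) : Φ u + Φ (1 - u) = 1 := by
  subst hΦ
  simp only [sub_sub_cancel]
  rw [show π * (1 - u) = π - π * u by ring, Real.cos_pi_sub, add_comm (Real.sinc (π - π * u))]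
  ring

/-- `πx·cot x ≤ 1`-type bound: `x cos x ≤ sin x` for `0 ≤ x ≤ π/2`. [cite: Ramare2001LOneApproximateFormulae, Lemma 7 (proof: «cot(πu) ≤ 1/(πu) for u ∈ [0,1]»)] -/
theorem mul_cos_le_sin {x : ℝ} (h0 : 0 ≤ x) (h1 : x ≤ π / 2) : x * Real.cos x ≤ Real.sin x := by
  rcases h1.eq_or_lt with rfl | h1'
  · simp
  · have hcos : 0 < Real.cos x := Real.cos_pos_of_mem_Ioo ⟨by linarith [Real.pi_pos], h1'⟩
    have ht := Real.le_tan h0 h1'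
    rw [Real.tan_eq_sin_div_cos, le_div_iff₀ hcos] at ht
    linarith

/-- **`0 ≤ Φ ≤ 1` on `[0,1]`** (Vaaler: `Ĵ ≥ 0`; Ramaré Lemma 15: `F₃ ≤ 1`). [cite: Vaaler1985, Thm. 6] -/
theorem vaalerPhi_mem_Icc
    (hΦ : Φ = fun u => Real.cos (π * u) / (Real.sinc (π * u) + Real.sinc (π * (1 - u))) + u)
    {u : ℝ} (hu : u ∈ Icc (0:ℝ) 1) : Φ u ∈ Icc (0:ℝ) 1 := by
  -- endpoints
  rcases hu.1.eq_or_lt with rfl | hu0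
  · rw [(vaalerPhi_zero_one hΦ).1]; exact ⟨zero_le_one, le_rfl⟩
  rcases hu.2.eq_or_lt with rfl | hu1
  · rw [(vaalerPhi_zero_one hΦ).2]; exact ⟨le_rfl, zero_le_one⟩
  -- symmetric reduction: it suffices to treat `u ≤ 1/2` for both bounds, via `Φ(u) + Φ(1−u) = 1`
  have key : ∀ v : ℝ, 0 < v → v ≤ 1 / 2 → Φ v ∈ Icc (0:ℝ) 1 := by
    intro v hv0 hv
    rw [vaalerPhi_eq_of_mem_Ioo hΦ ⟨hv0, by linarith⟩]
    have hs : 0 < Real.sin (π * v) :=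
      Real.sin_pos_of_pos_of_lt_pi (by positivity) (by nlinarith [Real.pi_pos])
    have hc : 0 ≤ Real.cos (π * v) := Real.cos_nonneg_of_mem_Icc
      ⟨by nlinarith [Real.pi_pos], by nlinarith [Real.pi_pos]⟩
    have hxc := mul_cos_le_sin (x := π * v) (by positivity) (by nlinarith [Real.pi_pos])
    have hcot : π * v * (Real.cos (π * v) / Real.sin (π * v)) ≤ 1 := by
      rw [← mul_div_assoc, div_le_one hs]; exact hxc
    have hcot0 : 0 ≤ π * v * (Real.cos (π * v) / Real.sin (π * v)) := by positivity
    constructor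
    · have : 0 ≤ (1 - v) * (π * v * (Real.cos (π * v) / Real.sin (π * v))) :=
        mul_nonneg (by linarith) hcot0
      nlinarith
    · have : (1 - v) * (π * v * (Real.cos (π * v) / Real.sin (π * v))) ≤ (1 - v) * 1 :=
        mul_le_mul_of_nonneg_left hcot (by linarith)
      nlinarith
  rcases le_or_gt u (1 / 2) with h | h
  · exact key u hu0 h
  · have h1 := key (1 - u) (by linarith) (by linarith)
    have h2 := vaalerPhi_add_vaalerPhi_one_sub hΦ u
    constructor <;> linarith [h1.1, h1.2]

/-- `1 − cos x ≤ x²/2`. [folklore] -/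
private theorem one_sub_cos_le (x : ℝ) : 1 - Real.cos x ≤ x ^ 2 / 2 := by
  linarith [Real.one_sub_sq_div_two_le_cos (x := x)]

/-- **The defect `(1 − Φ(u))/u` is small**: `≤ π²u/2` on `(0, 1/2]` and `≤ 2` on `[1/2, 1]`
(so `∫₀¹ (1−Φ(u))/u du ≤ π²/16 + 1 < 1.7`; the exact value is `log 2π − 1`, Ramaré's Lemma 7).
[cite: Ramare2001LOneApproximateFormulae, Lemma 7 p. 253] -/
theorem one_sub_vaalerPhi_div_le
    (hΦ : Φ = fun u => Real.cos (π * u) / (Real.sinc (π * u) + Real.sinc (π * (1 - u))) + u)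
    {u : ℝ} (hu : u ∈ Ioc (0:ℝ) 1) :
    0 ≤ (1 - Φ u) / u ∧
      (u ≤ 1 / 2 → (1 - Φ u) / u ≤ π ^ 2 * u / 2) ∧ (1 - Φ u) / u ≤ 5 / 2 := by
  have hmem := vaalerPhi_mem_Icc hΦ ⟨hu.1.le, hu.2⟩
  have h0 : 0 ≤ (1 - Φ u) / u := div_nonneg (by linarith [hmem.2]) hu.1.le
  have hsmall : u ≤ 1 / 2 → (1 - Φ u) / u ≤ π ^ 2 * u / 2 := by
    intro h
    rw [vaalerPhi_eq_of_mem_Ioo hΦ ⟨hu.1, by linarith⟩]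
    have hs : 0 < Real.sin (π * u) :=
      Real.sin_pos_of_pos_of_lt_pi (by nlinarith [Real.pi_pos, hu.1]) (by nlinarith [Real.pi_pos])
    have hc : 0 ≤ Real.cos (π * u) := Real.cos_nonneg_of_mem_Icc
      ⟨by nlinarith [Real.pi_pos, hu.1], by nlinarith [Real.pi_pos]⟩
    -- `πu cot(πu) ≥ cos(πu)` since `sin(πu) ≤ πu`
    have hsinle : Real.sin (π * u) ≤ π * u := Real.sin_le (by nlinarith [Real.pi_pos, hu.1])
    have hcot : Real.cos (π * u) ≤ π * u * (Real.cos (π * u) / Real.sin (π * u)) := by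
      rw [← mul_div_assoc, le_div_iff₀ hs]
      calc Real.cos (π * u) * Real.sin (π * u) ≤ Real.cos (π * u) * (π * u) :=
            mul_le_mul_of_nonneg_left hsinle hc
        _ = π * u * Real.cos (π * u) := by ring
    have hcos := one_sub_cos_le (π * u)
    have hcot1 : π * u * (Real.cos (π * u) / Real.sin (π * u)) ≤ 1 := by
      rw [← mul_div_assoc, div_le_one hs]
      exact mul_cos_le_sin (by nlinarith [Real.pi_pos, hu.1]) (by nlinarith [Real.pi_pos])
    rw [div_le_iff₀ hu.1]
    have e : 1 - (π * u * (1 - u) * (Real.cos (π * u) / Real.sin (π * u)) + u) =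
        (1 - u) * (1 - π * u * (Real.cos (π * u) / Real.sin (π * u))) := by ring
    rw [e]
    calc (1 - u) * (1 - π * u * (Real.cos (π * u) / Real.sin (π * u)))
        ≤ 1 * (1 - Real.cos (π * u)) := by
          apply mul_le_mul (by linarith [hu.1]) (by linarith [hcot]) (by linarith [hcot1]) zero_le_one
      _ ≤ (π * u) ^ 2 / 2 := by rw [one_mul]; exact hcos
      _ = π ^ 2 * u / 2 * u := by ring
  refine ⟨h0, hsmall, ?_⟩
  rcases le_or_gt u (1 / 2) with h | h
  · calc (1 - Φ u) / u ≤ π ^ 2 * u / 2 := hsmall h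
      _ ≤ π ^ 2 * (1 / 2) / 2 := by gcongr
      _ ≤ 5 / 2 := by
          have hπ2 : π ^ 2 < 3.15 ^ 2 := by gcongr; exact Real.pi_lt_d2
          nlinarith
  · rw [div_le_iff₀ hu.1]
    nlinarith [hmem.1]

/-- **`∫₀¹ Φ = 1/2`** (by `Φ(u) + Φ(1−u) = 1`). [cite: Vaaler1985, Thm. 6] -/
theorem integral_vaalerPhi
    (hΦ : Φ = fun u => Real.cos (π * u) / (Real.sinc (π * u) + Real.sinc (π * (1 - u))) + u) :
    ∫ u in (0:ℝ)..1, Φ u = 1 / 2 := by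
  have hint : IntervalIntegrable Φ volume 0 1 :=
    (continuousOn_vaalerPhi hΦ).intervalIntegrable_of_Icc zero_le_one
  have h1 : ∫ u in (0:ℝ)..1, Φ (1 - u) = ∫ u in (0:ℝ)..1, Φ u := by
    rw [intervalIntegral.integral_comp_sub_left Φ (1:ℝ)]; norm_num
  have hint' : IntervalIntegrable (fun u => Φ (1 - u)) volume 0 1 := by
    have := (hint.comp_sub_left 1)
    norm_num at this
    exact this.symm
  have h2 : ∫ u in (0:ℝ)..1, (Φ u + Φ (1 - u)) = 1 := by
    simp_rw [vaalerPhi_add_vaalerPhi_one_sub hΦ]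
    simp
  rw [intervalIntegral.integral_add hint hint', h1] at h2
  linarith

end Phi


/-! ## The compactly supported spectrum `G(y) = 2Φ(|y|)` (`|y| ≤ 1`), `0` (`|y| > 1`) -/

section G

variable {Φ G : ℝ → ℝ}

/-- `G` is continuous. [cite: Vaaler1985, Thm. 6] -/
theorem continuous_vaalerG
    (hΦ : Φ = fun u => Real.cos (π * u) / (Real.sinc (π * u) + Real.sinc (π * (1 - u))) + u)
    (hG : G = fun y => if |y| ≤ 1 then 2 * Φ |y| else 0) : Continuous G := by
  subst hG
  refine continuous_if_le continuous_abs continuous_const ?_ continuousOn_const fun y hy => ?_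
  · have h1 : ContinuousOn (fun y : ℝ => Φ |y|) {x : ℝ | |x| ≤ 1} :=
      (continuousOn_vaalerPhi hΦ).comp continuous_abs.continuousOn
        fun y hy => ⟨abs_nonneg y, hy⟩
    exact continuousOn_const.mul h1
  · rw [hy, (vaalerPhi_zero_one hΦ).2, mul_zero]

/-- `G(y) = 0` for `|y| ≥ 1`. [cite: Vaaler1985, Thm. 6] -/
theorem vaalerG_eq_zero
    (hΦ : Φ = fun u => Real.cos (π * u) / (Real.sinc (π * u) + Real.sinc (π * (1 - u))) + u)
    (hG : G = fun y => if |y| ≤ 1 then 2 * Φ |y| else 0) {y : ℝ} (hy : 1 ≤ |y|) : G y = 0 := by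
  subst hG
  simp only
  split_ifs with h
  · rw [le_antisymm h hy, (vaalerPhi_zero_one hΦ).2, mul_zero]
  · rfl

/-- `G(0) = 2`. [cite: Vaaler1985, Thm. 6] -/
theorem vaalerG_zero
    (hΦ : Φ = fun u => Real.cos (π * u) / (Real.sinc (π * u) + Real.sinc (π * (1 - u))) + u)
    (hG : G = fun y => if |y| ≤ 1 then 2 * Φ |y| else 0) : G 0 = 2 := by
  subst hG
  simp [(vaalerPhi_zero_one hΦ).1]

/-- `G` is even. [cite: Vaaler1985, Thm. 6] -/
theorem vaalerG_neg (hG : G = fun y => if |y| ≤ 1 then 2 * Φ |y| else 0) (y : ℝ) :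
    G (-y) = G y := by
  subst hG; simp only [abs_neg]

/-- On `(0,1)`: `G(u) = 2(u + πu(1−u)cot(πu))`. [cite: Vaaler1985, Thm. 6] -/
theorem vaalerG_eq_of_mem_Ioo
    (hΦ : Φ = fun u => Real.cos (π * u) / (Real.sinc (π * u) + Real.sinc (π * (1 - u))) + u)
    (hG : G = fun y => if |y| ≤ 1 then 2 * Φ |y| else 0) {u : ℝ} (hu : u ∈ Ioo (0:ℝ) 1) :
    G u = 2 * (u + π * u * (1 - u) * (Real.cos (π * u) / Real.sin (π * u))) := by
  subst hG
  simp only [abs_of_pos hu.1, if_pos hu.2.le, vaalerPhi_eq_of_mem_Ioo hΦ hu]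
  ring

/-- **The inverse Fourier integral of `G` is `W`**:
`∫ G(u) e^{2πiuy} du = 4∫₀¹ (t + πt(1−t)cot πt) cos(2πyt) dt` (`= H′(y)`, Vaaler's Theorem 6).
[cite: Vaaler1985, Thm. 6] -/
theorem integral_vaalerG_mul_cexp
    (hΦ : Φ = fun u => Real.cos (π * u) / (Real.sinc (π * u) + Real.sinc (π * (1 - u))) + u)
    (hG : G = fun y => if |y| ≤ 1 then 2 * Φ |y| else 0) (y : ℝ) :
    ∫ u : ℝ, (G u : ℂ) * cexp (2 * π * I * u * y) =
      ((4 * ∫ t in (0:ℝ)..1, (t + π * t * (1 - t) * (Real.cos (π * t) / Real.sin (π * t))) *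
        Real.cos (2 * π * y * t) : ℝ) : ℂ) := by
  have hGc := continuous_vaalerG hΦ hG
  set f : ℝ → ℂ := fun u => (G u : ℂ) * cexp (2 * π * I * u * y) with hf
  have hfc : Continuous f := by simp only [hf]; fun_prop
  -- restrict to `[-1, 1]`
  have h1 : ∫ u : ℝ, f u = ∫ u in (-1:ℝ)..1, f u := by
    rw [intervalIntegral.integral_of_le (by norm_num : (-1:ℝ) ≤ 1), ← integral_Icc_eq_integral_Ioc,
      setIntegral_eq_integral_of_forall_compl_eq_zero]
    intro u hu
    simp only [mem_Icc, not_and_or, not_le] at hu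
    have : 1 ≤ |u| := by
      rcases hu with h | h
      · rw [abs_of_neg (by linarith)]; linarith
      · rw [abs_of_pos (by linarith)]; linarith
    simp [hf, vaalerG_eq_zero hΦ hG this]
  -- fold `[-1,0]` onto `[0,1]`
  have h2 : ∫ u in (-1:ℝ)..1, f u = ∫ u in (0:ℝ)..1, (f u + f (-u)) := by
    have hneg : ∫ u in (-1:ℝ)..0, f u = ∫ u in (0:ℝ)..1, f (-u) := by
      have := intervalIntegral.integral_comp_neg (a := (0:ℝ)) (b := 1) f
      simp only [neg_zero] at this
      exact this.symm
    have hfn : Continuous fun u : ℝ => f (-u) := hfc.comp' continuous_neg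
    rw [← intervalIntegral.integral_add_adjacent_intervals (b := 0)
      (hfc.intervalIntegrable _ _) (hfc.intervalIntegrable _ _), hneg,
      ← intervalIntegral.integral_add (hfn.intervalIntegrable _ _) (hfc.intervalIntegrable _ _)]
    exact intervalIntegral.integral_congr fun u _ => by ring
  -- the integrand on `(0,1)`
  have h3 : ∫ u in (0:ℝ)..1, (f u + f (-u)) = ∫ u in (0:ℝ)..1,
      ((4 * ((u + π * u * (1 - u) * (Real.cos (π * u) / Real.sin (π * u))) *
        Real.cos (2 * π * y * u)) : ℝ) : ℂ) := by
    have hae : ∀ᵐ u : ℝ, u ≠ 1 := by rw [ae_iff]; simp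
    refine intervalIntegral.integral_congr_ae ?_
    filter_upwards [hae] with u hu1 hu
    rw [uIoc_of_le zero_le_one] at hu
    have hu' : u ∈ Ioo (0:ℝ) 1 := ⟨hu.1, lt_of_le_of_ne hu.2 hu1⟩
    have hev : f u + f (-u) = (G u : ℂ) * (2 * Real.cos (2 * π * u * y)) := by
      simp only [hf, vaalerG_neg hG]
      set θ : ℝ := 2 * π * u * y with hθ
      have e1 : (2 * π * I * u * y : ℂ) = (θ : ℂ) * I := by rw [hθ]; push_cast; ring
      have e2 : (2 * π * I * ((-u : ℝ) : ℂ) * y : ℂ) = ((-θ : ℝ) : ℂ) * I := by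
        rw [hθ]; push_cast; ring
      rw [e1, e2, Complex.exp_mul_I, Complex.exp_mul_I]
      push_cast
      rw [Complex.cos_neg, Complex.sin_neg]
      ring
    rw [hev, vaalerG_eq_of_mem_Ioo hΦ hG hu']
    push_cast
    ring_nf
  rw [h1, h2, h3, intervalIntegral.integral_ofReal, intervalIntegral.integral_const_mul]

end G


/-! ## Poisson summation for the samples of `W = H′`, and Ramaré's Lemma 16 -/

section Sums

variable {Φ G W : ℝ → ℝ}

/-- **`Σ_{k∈ℤ} W(δk) = 2/δ` for `0 < δ ≤ 1`** (Poisson summation: the dual side is `δ⁻¹ Σ_n G(n/δ) =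
δ⁻¹ G(0)`, since `G` vanishes off `(−1, 1)`). [cite: Vaaler1985, Thm. 8 (proof, Poisson step (2.37))] -/
theorem hasSum_int_vaalerW
    (hΦ : Φ = fun u => Real.cos (π * u) / (Real.sinc (π * u) + Real.sinc (π * (1 - u))) + u)
    (hG : G = fun y => if |y| ≤ 1 then 2 * Φ |y| else 0)
    (hW : W = fun x => 4 * ∫ t in (0:ℝ)..1,
      (t + π * t * (1 - t) * (Real.cos (π * t) / Real.sin (π * t))) * Real.cos (2 * π * x * t))
    {δ : ℝ} (hδ : 0 < δ) (hδ1 : δ ≤ 1) :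
    HasSum (fun k : ℤ => W (δ * k)) (2 / δ) := by
  have hV : ∀ y : ℝ, ((W y : ℝ) : ℂ) = ∫ u : ℝ, ((G u : ℝ) : ℂ) * cexp (2 * π * I * u * y) := by
    intro y; rw [integral_vaalerG_mul_cexp hΦ hG y, hW]
  have hdec : ∀ y : ℝ, ‖((W y : ℝ) : ℂ)‖ ≤ 10 * Real.exp (2 * π) / (1 + y ^ 2) := by
    intro y; rw [Complex.norm_real, Real.norm_eq_abs, hW]; exact abs_vaalerW_le_div_one_add_sq y
  have hG0 : ∀ u : ℝ, 1 ≤ |u| → ((G u : ℝ) : ℂ) = 0 := fun u hu => by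
    rw [vaalerG_eq_zero hΦ hG hu, Complex.ofReal_zero]
  have hGc : Continuous fun u : ℝ => ((G u : ℝ) : ℂ) :=
    Complex.continuous_ofReal.comp (continuous_vaalerG hΦ hG)
  have h := tsum_progression_eq_of_bandlimited (V := fun y => ((W y : ℝ) : ℂ)) hGc hG0 hV hdec
    hδ Nat.one_pos 0
  simp only [Int.cast_zero, zero_add, Nat.cast_one, one_mul, mul_one, zero_div, Complex.ofReal_zero,
    zero_mul, mul_zero, Complex.exp_zero, Int.cast_zero] at h
  -- the dual sum is `G(0) = 2`
  have hGn : ∀ n : ℤ, n ≠ 0 → ((G (n / δ) : ℝ) : ℂ) = 0 := by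
    intro n hn
    apply hG0
    rw [abs_div, abs_of_pos hδ, le_div_iff₀ hδ, one_mul]
    have : (1 : ℝ) ≤ |(n : ℝ)| := by
      rw [← Int.cast_abs]; exact_mod_cast Int.one_le_abs hn
    linarith
  have hsumG : ∑' n : ℤ, (1 : ℂ) * ((G (n / δ) : ℝ) : ℂ) = 2 := by
    rw [tsum_eq_single 0 fun n hn => by rw [hGn n hn, mul_zero]]
    simp [vaalerG_zero hΦ hG]
  have hsumG' : ∑' n : ℤ, cexp (2 * π * I * ((0 : ℝ) : ℂ) * (n : ℝ)) * ((G (n / δ) : ℝ) : ℂ) = 2 := by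
    rw [← hsumG]; refine tsum_congr fun n => ?_; simp
  -- summability and the value of the `ℤ`-sum
  have hsumm : Summable fun k : ℤ => ((W (δ * k) : ℝ) : ℂ) :=
    summable_int_of_norm_le_div (C := 10 * Real.exp (2 * π)) hδ fun k => hdec _
  have hval : ∑' k : ℤ, ((W (δ * k) : ℝ) : ℂ) = ((2 / δ : ℝ) : ℂ) := by
    have h' : ∑' k : ℤ, ((W (δ * k) : ℝ) : ℂ) =
        (((δ * (1 : ℕ))⁻¹ : ℝ) : ℂ) * ∑' n : ℤ,
          cexp (2 * π * I * (((0 : ℤ) : ℝ) / ((1 : ℕ) : ℝ) : ℝ) * (n : ℝ)) * ((G (n / (δ * (1 : ℕ))) : ℝ) : ℂ) := by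
      have := tsum_progression_eq_of_bandlimited (V := fun y => ((W y : ℝ) : ℂ)) hGc hG0 hV hdec
        hδ Nat.one_pos 0
      simpa only [Int.cast_zero, zero_add, Nat.cast_one, one_mul] using this
    rw [h']
    simp only [Nat.cast_one, mul_one, Int.cast_zero, zero_div]
    rw [hsumG']
    push_cast
    field_simp
  have hC : HasSum (fun k : ℤ => ((W (δ * k) : ℝ) : ℂ)) ((2 / δ : ℝ) : ℂ) := hval ▸ hsumm.hasSum
  exact Complex.hasSum_ofReal.1 hC

/-- **`Σ_{n≥1} W(δn) = 1/δ − 1` for `0 < δ ≤ 1`** (`W` even, `W(0) = 2`).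
[cite: Ramare2001LOneApproximateFormulae, Lemma 16 p. 259 (proof)] -/
theorem hasSum_nat_vaalerW
    (hΦ : Φ = fun u => Real.cos (π * u) / (Real.sinc (π * u) + Real.sinc (π * (1 - u))) + u)
    (hG : G = fun y => if |y| ≤ 1 then 2 * Φ |y| else 0)
    (hW : W = fun x => 4 * ∫ t in (0:ℝ)..1,
      (t + π * t * (1 - t) * (Real.cos (π * t) / Real.sin (π * t))) * Real.cos (2 * π * x * t))
    {δ : ℝ} (hδ : 0 < δ) (hδ1 : δ ≤ 1) :
    HasSum (fun n : ℕ => W (δ * (n + 1))) (1 / δ - 1) := by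
  have hZ := hasSum_int_vaalerW hΦ hG hW hδ hδ1
  have hW0 : W 0 = 2 := by rw [hW]; exact vaalerW_zero
  have heven : ∀ x : ℝ, W (-x) = W x := fun x => by rw [hW]; exact vaalerW_neg x
  -- the subseries over `n ≥ 1`
  have hsub : Summable fun n : ℕ => W (δ * (n + 1)) := by
    have h1 : Summable fun n : ℕ => W (δ * ((n : ℤ) : ℝ)) :=
      hZ.summable.comp_injective Nat.cast_injective
    have h2 := (summable_nat_add_iff 1).2 h1
    refine h2.congr fun n => ?_
    push_cast; ring_nf
  set P := ∑' n : ℕ, W (δ * (n + 1)) with hP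
  have hPsum : HasSum (fun n : ℕ => W (δ * (n + 1))) P := hsub.hasSum
  set f : ℤ → ℝ := fun k => W (δ * k) with hf
  have hf1 : HasSum (fun n : ℕ => (fun m : ℕ => f m) (n + 1)) P := by
    refine hPsum.congr_fun fun n => ?_
    simp only [hf]; push_cast; ring_nf
  have h1 : HasSum (fun m : ℕ => f m) (P + W 0) := by
    have h := (hasSum_nat_add_iff (f := fun m : ℕ => f m) 1).1 hf1
    simpa [hf] using h
  have h2 : HasSum (fun n : ℕ => f (-(n + 1))) P := by
    refine hPsum.congr_fun fun n => ?_
    simp only [hf]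
    rw [← heven]; push_cast; ring_nf
  have h3 := HasSum.of_nat_of_neg_add_one h1 h2
  have huniq := hZ.unique h3
  rw [hW0] at huniq
  have h2δ : (2 : ℝ) / δ = 2 * (1 / δ) := by ring
  rw [h2δ] at huniq
  have : P = 1 / δ - 1 := by linarith
  rwa [this] at hPsum

/-- **Ramaré's Lemma 16**: for `0 < δ ≤ 1`, `Σ_{n≥1} (1 − F₃(δn))/n = −log δ − 1 + δ`, where `F₃ = H = B − K`
is Vaaler's function. Ramaré's proof differentiates in `δ` and evaluates `Σ_n F₃′(δn)` by Fourier
analysis ((5.2)–(5.3), Vaaler's Thm 6); here `d/dδ Σ(1−H(δn))/n = −Σ_{n≥1} H′(δn) = 1 − 1/δ` by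
`hasSum_nat_vaalerW`, and the constant is fixed at `δ = 1` where `H(n) = 1`.
[cite: Ramare2001LOneApproximateFormulae, Lemma 16 p. 259] -/
theorem hasSum_one_sub_vaalerH_div {δ : ℝ} (hδ : 0 < δ) (hδ1 : δ ≤ 1) :
    HasSum (fun n : ℕ => (1 - (beurlingReal (δ * (n + 1)) - Real.sinc (π * (δ * (n + 1))) ^ 2)) / (n + 1))
      (-Real.log δ - 1 + δ) := by
  -- local names for the three functions
  set Φ : ℝ → ℝ := fun u => Real.cos (π * u) / (Real.sinc (π * u) + Real.sinc (π * (1 - u))) + u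
    with hΦ
  set G : ℝ → ℝ := fun y => if |y| ≤ 1 then 2 * Φ |y| else 0 with hG
  set W : ℝ → ℝ := fun x => 4 * ∫ t in (0:ℝ)..1,
      (t + π * t * (1 - t) * (Real.cos (π * t) / Real.sin (π * t))) * Real.cos (2 * π * x * t) with hW
  set term : ℕ → ℝ → ℝ := fun n y =>
    (1 - (beurlingReal (y * (n + 1)) - Real.sinc (π * (y * (n + 1))) ^ 2)) / (n + 1) with hterm
  -- termwise derivative
  have hderiv : ∀ n : ℕ, ∀ y : ℝ, HasDerivAt (term n) (-W (y * (n + 1))) y := by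
    intro n y
    have hn : (0 : ℝ) < n + 1 := by positivity
    have h1 := hasDerivAt_beurlingReal_sub_sinc_sq (y * (n + 1))
    have h2 : HasDerivAt (fun y : ℝ => y * (n + 1)) ((n : ℝ) + 1) y := by
      simpa using (hasDerivAt_id y).mul_const ((n : ℝ) + 1)
    have h3 := h1.comp y h2
    have h4 := ((h3.const_sub 1).div_const ((n : ℝ) + 1))
    refine (h4.congr_of_eventuallyEq (Eventually.of_forall fun z => by
      simp [hterm, Function.comp])).congr_deriv ?_
    rw [neg_div, mul_div_cancel_right₀ _ hn.ne']
  -- summability of the terms for `y > 0`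
  have hsumm : ∀ y : ℝ, 0 < y → Summable fun n => term n y := by
    intro y hy
    refine Summable.of_nonneg_of_le (fun n => ?_) (fun n => ?_)
      ((summable_nat_add_iff 1 |>.2 (Real.summable_one_div_nat_pow.2 (by norm_num : 1 < 3))).mul_left
        (1 / (π ^ 2 * y ^ 2)))
    · exact div_nonneg (one_sub_beurlingReal_sub_sinc_sq_nonneg (by positivity)) (by positivity)
    · have hle := one_sub_beurlingReal_sub_sinc_sq_le (x := y * (n + 1)) (by positivity)
      have hx : π * (y * (n + 1)) ≠ 0 := by positivity
      have hsinc : Real.sinc (π * (y * (n + 1))) ^ 2 ≤ 1 / (π * (y * (n + 1))) ^ 2 := by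
        rw [Real.sinc_of_ne_zero hx, div_pow]
        gcongr
        nlinarith [Real.sin_sq_le_one (π * (y * (n + 1)))]
      simp only [hterm]
      push_cast
      rw [div_le_iff₀ (by positivity : (0:ℝ) < n + 1)]
      calc 1 - (beurlingReal (y * (n + 1)) - Real.sinc (π * (y * (n + 1))) ^ 2)
          ≤ 1 / (π * (y * (n + 1))) ^ 2 := hle.trans hsinc
        _ = 1 / (π ^ 2 * y ^ 2) * (1 / ((n : ℝ) + 1) ^ 3) * (n + 1) := by
            field_simp
  -- the derivative series, locally uniformly dominated
  have hF : ∀ y : ℝ, 0 < y →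
      HasDerivAt (fun z => ∑' n, term n z) (∑' n : ℕ, -W (y * (n + 1))) y := by
    intro y hy
    have hyI : y ∈ Ioi (y / 2) := by simp only [mem_Ioi]; linarith
    refine hasDerivAt_tsum_of_isPreconnected (t := Ioi (y / 2)) (y₀ := y) (y := y)
      (u := fun n : ℕ => 10 * Real.exp (2 * π) / (1 + (y / 2) ^ 2 * ((n : ℝ) + 1) ^ 2)) ?_
      isOpen_Ioi isPreconnected_Ioi (fun n z _ => hderiv n z) ?_ hyI (hsumm y hy) hyI
    · have : Summable fun n : ℕ => 10 * Real.exp (2 * π) / (y / 2) ^ 2 * (1 / ((n : ℝ) + 1) ^ 2) := by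
        have := (summable_nat_add_iff 1 |>.2 (Real.summable_one_div_nat_pow.2 one_lt_two)).mul_left
          (10 * Real.exp (2 * π) / (y / 2) ^ 2)
        refine this.congr fun n => ?_
        push_cast; ring_nf
      refine Summable.of_nonneg_of_le (fun n => by positivity) (fun n => ?_) this
      have hpos : 0 < (y / 2) ^ 2 * ((n : ℝ) + 1) ^ 2 := by positivity
      have heq : 10 * Real.exp (2 * π) / (y / 2) ^ 2 * (1 / ((n : ℝ) + 1) ^ 2)
          = 10 * Real.exp (2 * π) / ((y / 2) ^ 2 * ((n : ℝ) + 1) ^ 2) := by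
        rw [mul_one_div, div_div]
      rw [heq]
      exact div_le_div_of_nonneg_left (by positivity) hpos (by linarith)
    · intro n z hz
      rw [norm_neg, Real.norm_eq_abs, hW]
      refine (abs_vaalerW_le_div_one_add_sq _).trans ?_
      apply div_le_div_of_nonneg_left (by positivity) (by positivity)
      have hz' : y / 2 < z := hz
      have : (y / 2) ^ 2 * ((n : ℝ) + 1) ^ 2 ≤ (z * (n + 1)) ^ 2 := by
        rw [mul_pow]; gcongr
      linarith
  -- value of the derivative for `0 < y ≤ 1`
  have hF' : ∀ y : ℝ, 0 < y → y ≤ 1 → HasDerivAt (fun z => ∑' n, term n z) (1 - 1 / y) y := by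
    intro y hy hy1
    have hs := hasSum_nat_vaalerW hΦ hG hW hy hy1
    have : ∑' n : ℕ, -W (y * ((n : ℝ) + 1)) = 1 - 1 / y := by
      rw [tsum_neg, hs.tsum_eq]; ring
    rw [← this]; exact hF y hy
  -- `E(y) = F(y) + log y − y` is constant on `[δ, 1]`
  set E : ℝ → ℝ := fun y => (∑' n, term n y) + Real.log y - y with hE
  have hEderiv : ∀ y : ℝ, 0 < y → y ≤ 1 → HasDerivAt E 0 y := by
    intro y hy hy1
    have := ((hF' y hy hy1).add (Real.hasDerivAt_log hy.ne')).sub (hasDerivAt_id y)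
    refine this.congr_deriv ?_
    ring
  have hconst := constant_of_has_deriv_right_zero (f := E) (a := δ) (b := 1)
    (fun y hy => (hEderiv y (by linarith [hy.1]) hy.2).continuousAt.continuousWithinAt)
    (fun y hy => (hEderiv y (by linarith [hy.1]) hy.2.le).hasDerivWithinAt) 1 ⟨hδ1, le_rfl⟩
  -- `E(1) = −1`
  have hE1 : E 1 = -1 := by
    have h0 : ∀ n : ℕ, term n 1 = 0 := by
      intro n
      simp only [hterm, one_mul]
      have := beurlingReal_sub_sinc_sq_natCast (n := n + 1) (by omega)
      push_cast at this
      rw [this]; simp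
    show (∑' n, term n 1) + Real.log 1 - 1 = -1
    rw [tsum_congr h0, tsum_zero, Real.log_one]; ring
  have hEδ : E δ = -1 := by rw [← hconst, hE1]
  have hval : ∑' n, term n δ = -Real.log δ - 1 + δ := by
    simp only [hE] at hEδ; linarith
  have := (hsumm δ hδ).hasSum
  rw [hval] at this
  refine this.congr_fun fun n => ?_
  simp only [hterm]

end Sums

end Literature.Analysis.Fourier
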